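import Summits.BirchSwinnertonDyer.BirchSwinnertonDyer.Theorems.ClassRecordThreeEulerHalvesAtThreeCartanCoverDefs
import Summits.BirchSwinnertonDyer.BirchSwinnertonDyer.Theorems.ClassRecordThreeEulerHalvesAtThreeCartanDegreeDefs
import Literature.NumberTheory.Automorphic.QuaternionLocalSplit
import HarnessLib

/-!
# Crux NUM `CartanOnePlaceDegreeLawAtThree`, analytic dictionary D1 — slice 2: the REDUCTION DATUM `O₀' ↠ M₂(𝔽_q)` (M0 as data),
# the homomorphism `ι(O₀'¹) → GL₂(𝔽_q)` with kernel `Γ̄(q)`, and the INDUCED MODULE of cusp forms on the disconnected full-level-`q` cover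

Seat `bsd-stepL-tam3-p1` g26 (LEAD of 19109 ∕ 23422; `--supports` 23422; design memo `HOME/tam3-p1/g26/NUM-LINES-AND-D1-DESIGN-g26.md` §4 (ii)–(iii),
bsd-idea-10 g16 `Cruxes/EulerHalvesAtThree/D1-ANALYTIC-DICTIONARY.md` rows M0 ∕ G). Continues `…CartanCoverDefs` (p726336).
* `coverSubring X q` — the cover order `O₀'` as a `Subring` of `X.B`.
* `CoverReduction X q` (DATA; its existence for a Cartan place `q ∈ C` is the print fact «the Eichler order is maximal at `q ∤ D M`, `O₀' ⊗ ℤ_q ≅ M₂(ℤ_q)`,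
  and `X.O ∕ q O₀' ≅ 𝔽_{q²}`» — NOT asserted in this file): a surjective ring map `red : O₀' → M₂(𝔽_q)` with kernel `q O₀'`, compatible with the reduced norm,
  carrying `X.O` onto a non-split Cartan subalgebra `𝔽_q[η]` (`η` without eigenvalue in `𝔽_q`).
* `CoverReduction.redHom : coverUnits X q →* GL (Fin 2) (ZMod q)` — PROVED: multiplicative, kernel EXACTLY `principalLevel X q` (`mem_ker_redHom_iff`), image in
  `det = 1` (`det_redHom`).
* `CoverReduction.IndCuspForm` — the `ℂ`-submodule of functions `f : GL₂(𝔽_q) → S₂(Γ̄(q))` with `f (redHom γ · g) = coverRep γ (f g)`: cusp forms on the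
  DISCONNECTED cover `GL₂(𝔽_q) ×^{ι(O₀'¹)} (Γ̄(q)∖ℍ)` (`q − 1` components when `redHom` is onto `SL₂(𝔽_q)` — strong approximation, print, not used), with the
  `GL₂(𝔽_q)`-representation `indRep` by right translation `(h · f)(g) = f (g h)` — PROVED to preserve the equivariance and to be a representation.
Definitions + elementary lemmas only; nothing about degrees, periods, NUM, (F2b♮) or any curve; BSD is proved for no curve.
[cite: KohenPacetti2016, §1.3 and §2 (arXiv:1403.7801v3 pp. 5–8)] [cite: VignerasLNM800, Ch. II §2 and Ch. III §5] [cite: Voight2021, 23.2.3 and Def. 23.4.1]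
-/

set_option linter.dupNamespace false
set_option autoImplicit false

noncomputable section

open scoped Classical Pointwise MatrixGroups

namespace Summit.BirchSwinnertonDyer.BirchSwinnertonDyer.Theorems.CartanCover

open Literature.NumberTheory.Automorphic

variable {D M : ℕ} {C : Finset ℕ}

/-! ## §1 The cover order as a subring -/

/-- The cover order `O₀'` as a `Subring` of `X.B` (closed under `·` and containing `1` by `isOrder_coverOrder`). -/
def coverSubring (X : CartanLevelCurveData D M C) (q : ℕ) : Subring X.B where
  carrier := coverOrder X q
  mul_mem' ha hb := (isOrder_coverOrder X q).mul_mem _ ha _ hb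
  one_mem' := (isOrder_coverOrder X q).one_mem
  add_mem' ha hb := (coverOrder X q).add_mem ha hb
  zero_mem' := (coverOrder X q).zero_mem
  neg_mem' ha := (coverOrder X q).neg_mem ha

/-- Membership in `coverSubring` is membership in `coverOrder` (definitional). -/
@[simp] theorem mem_coverSubring_iff (X : CartanLevelCurveData D M C) (q : ℕ) {x : X.B} :
    x ∈ coverSubring X q ↔ x ∈ coverOrder X q := Iff.rfl

/-- The element of `O₀'` under a unit `g ∈ ι(O₀'¹)` (the `x` with `ι x = g`; unique by injectivity of `ι`). -/
def unitLift {X : CartanLevelCurveData D M C} {q : ℕ} (g : coverUnits X q) : coverSubring X q :=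
  ⟨Classical.choose g.2.1, (Classical.choose_spec g.2.1).1⟩

/-- `ι (unitLift g) = g`. -/
theorem ι_unitLift {X : CartanLevelCurveData D M C} {q : ℕ} (g : coverUnits X q) :
    X.ι (unitLift g : X.B) = ((g : GL (Fin 2) ℝ) : Matrix (Fin 2) (Fin 2) ℝ) :=
  (Classical.choose_spec g.2.1).2

/-- `unitLift` is characterised by `ι x = g`. -/
theorem unitLift_eq_of_ι_eq {X : CartanLevelCurveData D M C} {q : ℕ} (g : coverUnits X q) {x : X.B} (hx : x ∈ coverOrder X q)
    (h : X.ι x = ((g : GL (Fin 2) ℝ) : Matrix (Fin 2) (Fin 2) ℝ)) : unitLift g = ⟨x, hx⟩ := by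
  apply Subtype.ext
  exact X.ι_injective (by rw [ι_unitLift, h])

/-- `unitLift 1 = 1`. -/
theorem unitLift_one {X : CartanLevelCurveData D M C} {q : ℕ} : unitLift (1 : coverUnits X q) = 1 :=
  unitLift_eq_of_ι_eq 1 (isOrder_coverOrder X q).one_mem (by simp)

/-- `unitLift (g h) = unitLift g * unitLift h`. -/
theorem unitLift_mul {X : CartanLevelCurveData D M C} {q : ℕ} (g h : coverUnits X q) : unitLift (g * h) = unitLift g * unitLift h := by
  refine unitLift_eq_of_ι_eq (g * h) ((isOrder_coverOrder X q).mul_mem _ (unitLift g).2 _ (unitLift h).2) ?_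
  rw [map_mul]
  change X.ι (unitLift g : X.B) * X.ι (unitLift h : X.B) = _
  rw [ι_unitLift, ι_unitLift, Subgroup.coe_mul, Units.val_mul]

/-- `unitLift g * unitLift g⁻¹ = 1`. -/
theorem unitLift_mul_unitLift_inv {X : CartanLevelCurveData D M C} {q : ℕ} (g : coverUnits X q) : unitLift g * unitLift g⁻¹ = 1 := by
  rw [← unitLift_mul, mul_inv_cancel, unitLift_one]

/-- `unitLift g⁻¹ * unitLift g = 1`. -/
theorem unitLift_inv_mul_unitLift {X : CartanLevelCurveData D M C} {q : ℕ} (g : coverUnits X q) : unitLift g⁻¹ * unitLift g = 1 := by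
  rw [← unitLift_mul, inv_mul_cancel, unitLift_one]

/-! ## §2 The reduction datum (M0 as data) -/

/-- **A REDUCTION of the cover order modulo `q`** (print fact M0 turned into data): a surjective ring homomorphism `red : O₀' → M₂(𝔽_q)` with kernel
`q O₀'`, whose determinant is the reduced norm mod `q`, together with a matrix `η` without eigenvalue in `𝔽_q` such that `X.O` is EXACTLY the preimage of the
non-split Cartan subalgebra `𝔽_q[η] = {a + b η}`. For a Cartan place `q ∈ C` such a datum exists (Eichler order maximal at `q ∤ D M`, `O₀' ⊗ ℤ_q ≅ M₂(ℤ_q)`;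
`X.O ∕ qO₀' ≅ 𝔽_{q²}` by `relIndex_eq` ∕ `isDivisionRing_mod`) — that existence is a print fact NOT asserted here.
[cite: Voight2021, 23.2.3 and Def. 23.4.1] [cite: KohenPacetti2016, §2 (arXiv:1403.7801v3 pp. 7–8)] -/
structure CoverReduction (X : CartanLevelCurveData D M C) (q : ℕ) where
  /-- the reduction map `O₀' → M₂(𝔽_q)`. -/
  red : coverSubring X q →+* Matrix (Fin 2) (Fin 2) (ZMod q)
  /-- `red` is onto. -/
  red_surjective : Function.Surjective red
  /-- `ker red = q O₀'`. -/
  red_eq_zero_iff : ∀ x : coverSubring X q, red x = 0 ↔ ∃ y ∈ coverOrder X q, (x : X.B) = (q : ℤ) • y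
  /-- `det ∘ red = nrd mod q` on `O₀'`. -/
  det_red : ∀ x : coverSubring X q, ∃ n : ℤ, reducedNorm ℚ X.B (x : X.B) = n ∧ (red x).det = (n : ZMod q)
  /-- a generator of the residue field of `X.O` at `q`: a matrix with irreducible characteristic polynomial. -/
  η : Matrix (Fin 2) (Fin 2) (ZMod q)
  /-- `η` has no eigenvalue in `𝔽_q`. -/
  η_irred : ¬ CartanDegree.HasRatEigenvalue η
  /-- `X.O = red⁻¹(𝔽_q[η])`. -/
  mem_O_iff : ∀ x : coverSubring X q, (x : X.B) ∈ X.O ↔ ∃ a b : ZMod q, red x = a • (1 : Matrix (Fin 2) (Fin 2) (ZMod q)) + b • η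

namespace CoverReduction

variable {X : CartanLevelCurveData D M C} {q : ℕ} (R : CoverReduction X q)

/-- **`redHom : ι(O₀'¹) → GL₂(𝔽_q)`**, `g ↦ red (lift g)` (invertible with inverse `red (lift g⁻¹)`). -/
def redHom : coverUnits X q →* GL (Fin 2) (ZMod q) where
  toFun g :=
    { val := R.red (unitLift g)
      inv := R.red (unitLift g⁻¹)
      val_inv := by rw [← map_mul, unitLift_mul_unitLift_inv, map_one]
      inv_val := by rw [← map_mul, unitLift_inv_mul_unitLift, map_one] }
  map_one' := by ext : 1; simp [unitLift_one]
  map_mul' g h := by ext : 1; simp [unitLift_mul]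

/-- `redHom g` as a matrix is `red (lift g)`. -/
@[simp] theorem coe_redHom (g : coverUnits X q) : ((R.redHom g : GL (Fin 2) (ZMod q)) : Matrix (Fin 2) (Fin 2) (ZMod q)) = R.red (unitLift g) := rfl

/-- **`ker redHom = Γ̄(q)`**: `red (lift g) = 1 ↔ lift g ≡ 1 (mod q O₀') ↔ g ∈ principalLevel`. -/
theorem mem_ker_redHom_iff (g : coverUnits X q) : R.redHom g = 1 ↔ (g : GL (Fin 2) ℝ) ∈ principalLevel X q := by
  have key : R.redHom g = 1 ↔ R.red (unitLift g - 1) = 0 := by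
    rw [map_sub, map_one, sub_eq_zero]
    constructor
    · intro h; have := congrArg (fun u : GL (Fin 2) (ZMod q) => (u : Matrix (Fin 2) (Fin 2) (ZMod q))) h; simpa using this
    · intro h; ext : 1; simpa using h
  rw [key, R.red_eq_zero_iff]
  constructor
  · rintro ⟨y, hy, hxy⟩
    refine ⟨g.2, (unitLift g : X.B), (unitLift g).2, ι_unitLift g, y, hy, ?_⟩
    simpa using hxy
  · rintro ⟨-, x, hx, hxg, y, hy, hxy⟩
    have hl : unitLift g = ⟨x, hx⟩ := unitLift_eq_of_ι_eq g hx hxg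
    refine ⟨y, hy, ?_⟩
    rw [hl]
    simpa using hxy

/-- `det (redHom g) = 1` (the reduced norm of a norm-one unit is `1`). -/
theorem det_redHom (g : coverUnits X q) : ((R.redHom g : GL (Fin 2) (ZMod q)) : Matrix (Fin 2) (Fin 2) (ZMod q)).det = 1 := by
  obtain ⟨n, hn, hdet⟩ := R.det_red (unitLift g)
  have h1 : reducedNorm ℚ X.B (unitLift g : X.B) = 1 := by
    have h := AlgHom.det_eq_reducedNorm X.ι (unitLift g : X.B)
    rw [ι_unitLift, ← Matrix.GeneralLinearGroup.val_det_apply] at h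
    have hg : (g : GL (Fin 2) ℝ).det = 1 := g.2.2.2
    rw [hg, Units.val_one] at h
    exact (algebraMap ℚ ℝ).injective (by rw [map_one]; exact h.symm)
  rw [h1] at hn
  have hn1 : n = 1 := by exact_mod_cast hn.symm
  rw [coe_redHom, hdet, hn1, Int.cast_one]

/-! ## §3 The induced module: cusp forms on the disconnected full-level-`q` cover -/

/-- **`S₂` of the disconnected cover** `GL₂(𝔽_q) ×^{ι(O₀'¹)} (Γ̄(q)∖ℍ)`: functions `f : GL₂(𝔽_q) → S₂(Γ̄(q))` with `f (redHom γ · g) = ρ(γ) (f g)` for all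
`γ ∈ ι(O₀'¹)` — the induced module `Ind S₂(Γ̄(q))` along `redHom` (`Ind_{SL₂(𝔽_q)}^{GL₂(𝔽_q)}` when `redHom` is onto `SL₂(𝔽_q)`: components `≅ 𝔽_q^×`).
[cite: KohenPacetti2016, §2 (arXiv:1403.7801v3 pp. 7–8)] -/
def IndCuspForm : Submodule ℂ (GL (Fin 2) (ZMod q) → CuspForm (principalLevel X q) 2) where
  carrier := {f | ∀ (γ : coverUnits X q) (g : GL (Fin 2) (ZMod q)), f (R.redHom γ * g) = coverRep X q γ (f g)}
  add_mem' {f₁} {f₂} h₁ h₂ γ g := by simp only [Pi.add_apply, h₁ γ g, h₂ γ g, map_add]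
  zero_mem' γ g := by simp only [Pi.zero_apply, map_zero]
  smul_mem' c {f} h γ g := by simp only [Pi.smul_apply, h γ g, map_smul]

/-- Membership in the induced module (definitional). -/
theorem mem_IndCuspForm_iff (f : GL (Fin 2) (ZMod q) → CuspForm (principalLevel X q) 2) :
    f ∈ R.IndCuspForm ↔ ∀ (γ : coverUnits X q) (g : GL (Fin 2) (ZMod q)), f (R.redHom γ * g) = coverRep X q γ (f g) :=
  Iff.rfl

/-- Right translation `(h · f)(g) = f (g h)` preserves the induced module. -/
theorem rightTranslate_mem (h : GL (Fin 2) (ZMod q)) {f : GL (Fin 2) (ZMod q) → CuspForm (principalLevel X q) 2}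
    (hf : f ∈ R.IndCuspForm) : (fun g => f (g * h)) ∈ R.IndCuspForm := by
  intro γ g
  simp only [mul_assoc, hf γ (g * h)]

/-- **The `GL₂(𝔽_q)`-representation on the induced module** by right translation: `(indRep h f)(g) = f (g h)`. [cite: KohenPacetti2016, §2 (arXiv:1403.7801v3 pp. 7–8)] -/
def indRep : Representation ℂ (GL (Fin 2) (ZMod q)) R.IndCuspForm where
  toFun h :=
    { toFun f := ⟨fun g => f.1 (g * h), R.rightTranslate_mem h f.2⟩
      map_add' f₁ f₂ := by ext g : 2; rfl
      map_smul' c f := by ext g : 2; rfl }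
  map_one' := by
    apply LinearMap.ext; intro f; apply Subtype.ext; funext g
    simp
  map_mul' h₁ h₂ := by
    apply LinearMap.ext; intro f; apply Subtype.ext; funext g
    simp [mul_assoc]

/-- `(indRep h f) g = f (g h)`. -/
@[simp] theorem indRep_apply (h g : GL (Fin 2) (ZMod q)) (f : R.IndCuspForm) :
    (R.indRep h f).1 g = f.1 (g * h) := rfl

/-- The value at `1` of an element of the induced module is invariant under `ρ(γ)` composed with translation by `redHom γ`: `f (redHom γ) = ρ(γ) (f 1)`. -/
theorem apply_redHom (f : R.IndCuspForm) (γ : coverUnits X q) :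
    f.1 (R.redHom γ) = coverRep X q γ (f.1 1) := by
  simpa using f.2 γ 1

end CoverReduction

end Summit.BirchSwinnertonDyer.BirchSwinnertonDyer.Theorems.CartanCover

end
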